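import Literature.NumberTheory.EllipticCurves.CasselsTateLocalTerms
import Literature.NumberTheory.EllipticCurves.WeilPairingProofs
import Literature.NumberTheory.EllipticCurves.KummerImageIsotropyProofs
import HarnessLib

/-!
# The inputs of the first case of the Cassels–Tate pairing, from the tree's facts

Topic `NumberTheory/EllipticCurves`; namespace `Literature.NumberTheory.EllipticCurves`. One theorem,
**no named fact introduced** (D-0026): it assembles, for an elliptic curve `E/K` over a number field
and a level `m ≥ 2`, ALL the data and hypotheses under which the first case of Milne's construction
(*ADT* I, proof of Prop. 6.9; files `CasselsTateLocalTerms`, `CasselsTateFirstCase`) is carried out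
in the tree:

* a Weil pairing `e` on `E[m²](K̄)` with values in `μ_{m²}` — bilinear, alternating, non-degenerate,
  Galois equivariant — from the PROVED tree theorem `WeierstrassCurve.exists_weilPairing_holds`
  (Silverman, *AEC*, III.8.1);
* a family `inv` of local invariants at level `m²` which is perfect and satisfies the reciprocity
  `∑_v inv_v = 0` on global classes — from the named fact
  `poitouTate_sum_localTatePairing_eq_zero` (Milne I Thm. 4.10(b) with Cor. 2.3), CONSUMED as the
  hypothesis `hPT`;
* the isotropy of the local Kummer conditions `𝓛_v^{(m²)}` at every place for the level-`m²` Weil cup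
  product (`weilLocalCup`) — from the named fact `kummerClass_cupProduct_kummerClass_eq_zero` at the
  completions (Poonen–Rains 2012, Prop. 4.8), CONSUMED as the hypothesis `hiso`.

Motivation: provefact `WeierstrassCurve.exists_casselsTate_pairing`.

## References

* [MilneADT2006] J. S. Milne, *Arithmetic Duality Theorems*, 2nd ed. (2006), Ch. I §6, proof of
  Prop. 6.9; Thm. 4.10(b); Cor. 2.3.
* [SilvermanAEC2009] J. H. Silverman, *The Arithmetic of Elliptic Curves*, 2nd ed. (2009),
  Prop. III.8.1, Thm. X.4.14.
* [PoonenRains2012] B. Poonen, E. Rains, *Random maximal isotropic subspaces and Selmer groups*,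
  J. Amer. Math. Soc. 25 (2012), Prop. 4.8.
-/

noncomputable section

open scoped Classical

universe u

namespace Literature.NumberTheory.EllipticCurves

open CategoryTheory _root_.WeierstrassCurve Field NumberField
open Literature.NumberTheory.GaloisRepresentations Literature.NumberTheory.GaloisCohomology
open Literature.NumberTheory.GaloisRepresentations.DiscreteGaloisModule (mu MuCarrier pairing)
open scoped ContRepresentation

-- Cup products need `LocallyCompactSpace Γ`; as in the tree's cup-product files, the compactness of
-- absolute Galois groups is a local instance only.
attribute [local instance] absoluteGaloisGroup_compactSpace

/-- **The inputs of the first case of the Cassels–Tate pairing at level `m ≥ 2`, from the tree's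
facts**: a Weil pairing `e` on `E[m²]` (bilinear with values in `μ_{m²}`, Galois equivariant,
alternating, non-degenerate), a perfect family of local invariants at level `m²` with the
reciprocity law (`hPT`), and the isotropy of all local Kummer conditions at level `m²` for the local
Weil cup products (`hiso`). [cite: MilneADT2006, Ch. I §6, proof of Prop. 6.9] -/
theorem exists_firstCaseInputs_of_facts {K : Type u} [Field K] [NumberField K]
    (W : WeierstrassCurve K) [W.IsElliptic] (m : ℕ) [NeZero m] (hm : 2 ≤ m)
    (hPT : poitouTate_sum_localTatePairing_eq_zero K)
    (hiso : ∀ v : Place K, kummerClass_cupProduct_kummerClass_eq_zero (Place.Completion v)) :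
    ∃ (e : geomTorsion W ((m * m : ℕ) : ℤ) → geomTorsion W ((m * m : ℕ) : ℤ) → AlgebraicClosure K)
      (hμ : ∀ S T, e S T ^ (m * m) = 1)
      (hadd₁ : ∀ S₁ S₂ T, e (S₁ + S₂) T = e S₁ T * e S₂ T)
      (hadd₂ : ∀ S T₁ T₂, e S (T₁ + T₂) = e S T₁ * e S T₂)
      (hgal : ∀ (σ : absoluteGaloisGroup K) (S T : geomTorsion W ((m * m : ℕ) : ℤ)),
        σ • e S T = e (σ • S) (σ • T)),
      (∀ T, e T T = 1) ∧ (∀ T, (∀ S, e S T = 1) → T = 0) ∧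
        ∃ inv : LocalInvariants K (m * m), inv.IsPerfect ∧ inv.SumLocalTermEqZero ∧
          ∀ (v : Place K) ⦃x y : galoisCohomology (GaloisRep.restrictField (Place.Completion v)
              (W.torsionGaloisModule ((m * m : ℕ) : ℤ))) 1⦄,
            x ∈ W.kummerLocalConditionAt ((m * m : ℕ) : ℤ) (Place.Completion v) →
              y ∈ W.kummerLocalConditionAt ((m * m : ℕ) : ℤ) (Place.Completion v) →
                weilLocalCup W m (Place.Completion v) e hμ hadd₁ hadd₂ hgal x y = 0 := by
  have hm2 : 2 ≤ m * m := le_trans hm (Nat.le_mul_self m)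
  have hchar : ((m * m : ℕ) : K) ≠ 0 := Nat.cast_ne_zero.mpr (NeZero.ne (m * m))
  obtain ⟨e, hμ, hadd₁, hadd₂, halt, hnd, hgal⟩ := W.exists_weilPairing_holds (m * m) hm2 hchar
  obtain ⟨inv, hperf, hsum⟩ := hPT (m * m)
  refine ⟨e, hμ, hadd₁, hadd₂, hgal, halt, hnd, inv, hperf, hsum, fun v x y hx hy => ?_⟩
  haveI := charZero_placeCompletion (K := K) v
  exact weilLocalCup_eq_zero_of_mem_of_fact W m (Place.Completion v) e hμ hadd₁ hadd₂ hgal (hiso v)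
    halt hx hy

/-- **The inputs of the first case of the Cassels–Tate pairing at level `m`, from Poitou–Tate
alone.** Same conclusion as `exists_firstCaseInputs_of_facts`, the isotropy of the local Kummer
images being now a theorem of the tree
(`Literature.NumberTheory.EllipticCurves.kummerClass_cupProduct_kummerClass_eq_zero_holds`,
file `KummerImageIsotropyProofs`: Poonen–Rains 2012, Prop. 4.8 / Cor. 4.6), applied over every
completion `K_v`.  The only remaining named-fact input of the first-case construction
(`CasselsTateFirstCase`) is the Poitou–Tate vanishing `poitouTate_sum_localTatePairing_eq_zero K`
(Milne, *ADT*, I Thm. 4.10(b)). [cite: MilneADT2006, Ch. I, proof of Prop. 6.9]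
[cite: PoonenRains2012, Prop. 4.8 and Cor. 4.6] -/
theorem exists_firstCaseInputs_of_poitouTate {K : Type u} [Field K] [NumberField K]
    (W : WeierstrassCurve K) [W.IsElliptic] (m : ℕ) [NeZero m] (hm : 2 ≤ m)
    (hPT : poitouTate_sum_localTatePairing_eq_zero K) :
    ∃ (e : geomTorsion W ((m * m : ℕ) : ℤ) → geomTorsion W ((m * m : ℕ) : ℤ) → AlgebraicClosure K)
      (hμ : ∀ S T, e S T ^ (m * m) = 1)
      (hadd₁ : ∀ S₁ S₂ T, e (S₁ + S₂) T = e S₁ T * e S₂ T)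
      (hadd₂ : ∀ S T₁ T₂, e S (T₁ + T₂) = e S T₁ * e S T₂)
      (hgal : ∀ (σ : absoluteGaloisGroup K) (S T : geomTorsion W ((m * m : ℕ) : ℤ)),
        σ • e S T = e (σ • S) (σ • T)),
      (∀ T, e T T = 1) ∧ (∀ T, (∀ S, e S T = 1) → T = 0) ∧
        ∃ inv : LocalInvariants K (m * m), inv.IsPerfect ∧ inv.SumLocalTermEqZero ∧
          ∀ (v : Place K) ⦃x y : galoisCohomology (GaloisRep.restrictField (Place.Completion v)
              (W.torsionGaloisModule ((m * m : ℕ) : ℤ))) 1⦄,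
            x ∈ W.kummerLocalConditionAt ((m * m : ℕ) : ℤ) (Place.Completion v) →
              y ∈ W.kummerLocalConditionAt ((m * m : ℕ) : ℤ) (Place.Completion v) →
                weilLocalCup W m (Place.Completion v) e hμ hadd₁ hadd₂ hgal x y = 0 :=
  exists_firstCaseInputs_of_facts W m hm hPT fun v ↦
    kummerClass_cupProduct_kummerClass_eq_zero_holds (Place.Completion v)

end Literature.NumberTheory.EllipticCurves
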